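import Mathlib
import Summits.Ventures.PercRepro2.Defs
import Summits.Ventures.PercRepro2.Independence
import Summits.Ventures.PercRepro2.Harris
import Summits.Ventures.PercRepro2.Graph
import Summits.Ventures.PercRepro2.Events
import Summits.Ventures.PercRepro2.BHKEvents
import Summits.Ventures.PercRepro2.RProduct
import Summits.Ventures.PercRepro2.CaseOnePendant

/-!
# The H-half of the weighted (PM) when `a₂` is a leaf at the host, and the weighted (PM) on that class
(blind cell PercRepro2, mine-2 g20; proofs/MINE2-CUTU.md Theorem 4 and Corollary 5, M2-42)

Same setting as `LeafRootPM.lean` (`a₂` a leaf at `u` through `e₀`, `β = p e₀`, `Q = {a₁ ↮ a₂}`).  The H-half,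
multiplied out by `P(Q)³`:

  `HALF_H := P(Q)·[P(Q) P(H_b L_u oU Q) − P(H_b Q) P(L_u oU Q)] − P(oU Q)·[P(Q) P(H_b L_u Q) − P(H_b Q) P(L_u Q)]
            − P(Q)·[P(Q) P(H_b L_o Q) − P(H_b Q) P(L_o Q)]`

(`= P(Q)³ · (Cov_Q(H_b, L_u 1[o∈U]) − p_o Cov_Q(H_b, L_u) − Cov_Q(H_b, L_o))`).  **Theorem `halfH_nonneg`: `0 ≤ HALF_H`.**
Dictionary (masses as in `LeafRootPM.lean`, plus `x_b = P({u ↔ b} Aᶜ)`, `y' = P(L_o {u ↔ b} Aᶜ)`):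
`P(H_b Q) = β x_b`, `P(L_u Q) = t_u(1 − β)`, `P(H_b L_u Q) = 0 = P(H_b L_u oU Q)`, `P(H_b L_o Q) = β y'`,
`P(L_u oU Q) = k_ou (1 − β)`; then the exact identity

  `(1 − t_u) · HALF_H = β · [ (1 − β) t_u x_b ((1 − β) C_ou + β (1 − t_u) x_o) + P(Q)² · D ]`,

`D = x_b m_o − y'(1 − t_u) ≥ 0` by BHK06 Thm 1.4 (`bhk_cross_cluster`: given `a₁ ↮ u` the clusters of `a₁` and `u`
are negatively correlated — `{o ∈ C_{a₁}}` against `{b ∈ C_u}`), `C_ou ≥ 0` by Harris.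

With `LeafRootPM.halfL_nonneg` this closes both per-side brackets of the weighted (PM) identity
`β₁ / P(Q)³ = HALF_L + HALF_H + (1 − p_u)(−X)` on the class «a root is a leaf at the host» (M2-35 (2); the third
term is BHK 1.4), i.e. row 2′BETA1 for every weight vector there (paper: MINE2-CUTU.md Corollary 5).
-/

namespace Summit.Ventures.PercRepro2

namespace LeafRootPMH

/-! ## Helpers (twins of `LeafRootPM.lean`, kept local so that this file elaborates on its own) -/

section Leaf

variable {V : Type*} {E : Type*} [Fintype E] [DecidableEq E] {ends : E → Sym2 V} {u a₂ : V} {e₀ : E}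

omit [Fintype E] [DecidableEq E] in
/-- A vertex `x ≠ a₂` is connected to the leaf `a₂` iff `e₀` is open and `x ↔ u`. -/
lemma conn_to_leaf_iff (hl : CaseOne.IsLeafAt ends u a₂ e₀) (ω : Config E) {x : V} (hx : x ≠ a₂) :
    Conn ends ω x a₂ ↔ ω e₀ = true ∧ Conn ends ω x u := by
  constructor
  · intro h
    have hopen : ω e₀ = true := by
      by_contra hne
      have hω : ω e₀ = false := by simpa using hne
      exact hx (CaseOne.eq_of_conn_leaf_of_closed hl hω (conn_symm h))
    refine ⟨hopen, conn_trans h ?_⟩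
    exact conn_symm ((CaseOne.conn_leaf_iff hl ω).2 hopen)
  · rintro ⟨hopen, h⟩
    exact conn_trans h ((CaseOne.conn_leaf_iff hl ω).2 hopen)

omit [Fintype E] [DecidableEq E] in
/-- `{x ↔ a₂} = {e₀ open} ∩ {x ↔ u}` for `x ≠ a₂`. -/
lemma connEvent_leaf (hl : CaseOne.IsLeafAt ends u a₂ e₀) {x : V} (hx : x ≠ a₂) :
    connEvent ends x a₂ = openEdge e₀ ∩ connEvent ends x u := by
  ext ω
  simp only [mem_connEvent, Set.mem_inter_iff, mem_openEdge]
  exact conn_to_leaf_iff hl ω hx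

omit [Fintype E] [DecidableEq E] in
/-- `{a₂ ↔ x} = {e₀ open} ∩ {x ↔ u}` for `x ≠ a₂`. -/
lemma connEvent_leaf' (hl : CaseOne.IsLeafAt ends u a₂ e₀) {x : V} (hx : x ≠ a₂) :
    connEvent ends a₂ x = openEdge e₀ ∩ connEvent ends x u := by
  rw [← connEvent_leaf hl hx]
  ext ω
  simp only [mem_connEvent]
  exact ⟨conn_symm, conn_symm⟩

omit [Fintype E] in
/-- A connection event between vertices `≠ a₂` is determined by the edges other than `e₀`. -/
lemma dependsOn_connEvent_of_leaf (hl : CaseOne.IsLeafAt ends u a₂ e₀) {x y : V} (hx : x ≠ a₂)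
    (hy : y ≠ a₂) : DependsOn (· ∈ connEvent ends x y) ({e₀}ᶜ : Set E) := by
  intro ω ω' h
  have hupd : Function.update ω e₀ false = Function.update ω' e₀ false := by
    funext e
    by_cases he : e = e₀
    · subst he; simp
    · rw [Function.update_of_ne he, Function.update_of_ne he]
      exact h e (by simpa using he)
  show (ω ∈ connEvent ends x y) = (ω' ∈ connEvent ends x y)
  apply propext
  simp only [mem_connEvent]
  rw [CaseOne.conn_iff_update_of_leaf hl ω hx hy, CaseOne.conn_iff_update_of_leaf hl ω' hx hy, hupd]

end Leaf

section Indep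

variable {E : Type*} [Fintype E] [DecidableEq E] {R : Type*} [CommRing R]

/-- An event determined by the edges other than `e₀` is independent of `{e₀ open}`. -/
lemma prob_inter_openEdge_of_dependsOn (p : E → R) {e₀ : E} {A : Set (Config E)}
    (hA : DependsOn (· ∈ A) ({e₀}ᶜ : Set E)) :
    prob p (A ∩ openEdge e₀) = prob p A * p e₀ := by
  rw [prob_inter_eq_mul_of_dependsOn p (F₁ := ({e₀}ᶜ : Set E)) (F₂ := ({e₀} : Set E))
    disjoint_compl_left hA (dependsOn_openEdge e₀), prob_openEdge]

omit [Fintype E] [DecidableEq E] in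
/-- Events determined by `{e₀}ᶜ` are closed under `∩`. -/
lemma dep_inter {e₀ : E} {A B : Set (Config E)} (hA : DependsOn (· ∈ A) ({e₀}ᶜ : Set E))
    (hB : DependsOn (· ∈ B) ({e₀}ᶜ : Set E)) : DependsOn (· ∈ A ∩ B) ({e₀}ᶜ : Set E) := by
  simpa using dependsOn_inter hA hB

end Indep

section SetAlgebra

variable {X : Type*}

/-- Set algebra: `Lb ∩ (O ∩ A) = (Lb ∩ A) ∩ O`. -/
lemma set_d1 (Lb O A : Set X) : Lb ∩ (O ∩ A) = (Lb ∩ A) ∩ O := by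
  ext ω; simp only [Set.mem_inter_iff]; tauto

/-- Set algebra: `O ∩ Xo ∩ (O ∩ A)ᶜ = (Xo ∩ Aᶜ) ∩ O`. -/
lemma set_d4 (Xo O A : Set X) : O ∩ Xo ∩ (O ∩ A)ᶜ = (Xo ∩ Aᶜ) ∩ O := by
  ext ω; simp only [Set.mem_inter_iff, Set.mem_compl_iff]; tauto

/-- Set algebra: `(Lo ∪ O ∩ Xo) ∩ (O ∩ A)ᶜ = (Lo ∩ (O ∩ A)ᶜ) ∪ ((Xo ∩ Aᶜ) ∩ O)`. -/
lemma set_d6 (Lo Xo O A : Set X) :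
    (Lo ∪ O ∩ Xo) ∩ (O ∩ A)ᶜ = (Lo ∩ (O ∩ A)ᶜ) ∪ ((Xo ∩ Aᶜ) ∩ O) := by
  ext ω; simp only [Set.mem_inter_iff, Set.mem_compl_iff, Set.mem_union]; tauto

end SetAlgebra

section SetAlgebraH

variable {X : Type*}

/-- Set algebra: `A ∩ (O ∩ A)ᶜ = A ∩ Oᶜ`. -/
lemma set_e2 (O A : Set X) : A ∩ (O ∩ A)ᶜ = A ∩ Oᶜ := by
  ext ω; simp only [Set.mem_inter_iff, Set.mem_compl_iff]; tauto

/-- Set algebra: `O ∩ Xb ∩ A ∩ (O ∩ A)ᶜ = ∅`. -/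
lemma set_e3 (Xb O A : Set X) : O ∩ Xb ∩ A ∩ (O ∩ A)ᶜ = ∅ := by
  ext ω; simp only [Set.mem_inter_iff, Set.mem_compl_iff, Set.mem_empty_iff_false]; tauto

/-- Set algebra: `O ∩ Xb ∩ Lo ∩ (O ∩ A)ᶜ = (Lo ∩ Xb ∩ Aᶜ) ∩ O`. -/
lemma set_e5 (Xb Lo O A : Set X) : O ∩ Xb ∩ Lo ∩ (O ∩ A)ᶜ = (Lo ∩ Xb ∩ Aᶜ) ∩ O := by
  ext ω; simp only [Set.mem_inter_iff, Set.mem_compl_iff]; tauto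

/-- Set algebra: `A ∩ (Lo ∪ O ∩ Xo) ∩ (O ∩ A)ᶜ = (Lo ∩ A) ∩ Oᶜ`. -/
lemma set_e7 (Lo Xo O A : Set X) : A ∩ (Lo ∪ O ∩ Xo) ∩ (O ∩ A)ᶜ = (Lo ∩ A) ∩ Oᶜ := by
  ext ω; simp only [Set.mem_inter_iff, Set.mem_compl_iff, Set.mem_union]; tauto

/-- Set algebra: `O ∩ Xb ∩ A ∩ (Lo ∪ O ∩ Xo) ∩ (O ∩ A)ᶜ = ∅`. -/
lemma set_e8 (Xb Lo Xo O A : Set X) : O ∩ Xb ∩ A ∩ (Lo ∪ O ∩ Xo) ∩ (O ∩ A)ᶜ = ∅ := by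
  ext ω; simp only [Set.mem_inter_iff, Set.mem_compl_iff, Set.mem_union, Set.mem_empty_iff_false]
  tauto

end SetAlgebraH

section MainH

variable {V : Type*} {E : Type*} [Fintype E] [DecidableEq E] [Fintype V] [DecidableEq V]
  {R : Type*} [CommRing R] [LinearOrder R] [IsStrictOrderedRing R]

omit [Fintype E] [DecidableEq E] [Fintype V] [DecidableEq V] in
/-- The connection event is symmetric. -/
lemma connEvent_comm (ends : E → Sym2 V) (x y : V) : connEvent ends x y = connEvent ends y x := by
  ext ω
  simp only [mem_connEvent]
  exact ⟨conn_symm, conn_symm⟩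

/-- An event determined by the edges other than `e₀` is independent of `{e₀ closed}`. -/
lemma prob_inter_compl_openEdge_of_dependsOn (p : E → R) {e₀ : E} {A : Set (Config E)}
    (hA : DependsOn (· ∈ A) ({e₀}ᶜ : Set E)) :
    prob p (A ∩ (openEdge e₀)ᶜ) = prob p A * (1 - p e₀) := by
  have := prob_inter_add_prob_inter_compl p A (openEdge e₀)
  rw [prob_inter_openEdge_of_dependsOn p hA] at this
  linarith

/-- **The H-half of the weighted (PM) is nonnegative when `a₂` is a leaf at the host `u`**
(proofs/MINE2-CUTU.md Theorem 4): with `Q = {a₁ ↮ a₂}`, `H_b = {a₂ ↔ b}`, `L_u = {a₁ ↔ u}`,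
`L_o = {a₁ ↔ o}`, `oU = {a₁ ↔ o} ∪ {a₂ ↔ o}`,
`0 ≤ P(Q)·[P(Q) P(H_b L_u oU Q) − P(H_b Q) P(L_u oU Q)] − P(oU Q)·[P(Q) P(H_b L_u Q) − P(H_b Q) P(L_u Q)]
      − P(Q)·[P(Q) P(H_b L_o Q) − P(H_b Q) P(L_o Q)]`. -/
theorem halfH_nonneg (p : E → R) (hp : IsProbVec p) (ends : E → Sym2 V) (o a₁ a₂ b u : V)
    (e₀ : E) (hl : CaseOne.IsLeafAt ends u a₂ e₀) (h1 : a₁ ≠ a₂) (ho : o ≠ a₂) (hb : b ≠ a₂) :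
    0 ≤ prob p (connEvent ends a₁ a₂)ᶜ *
          (prob p (connEvent ends a₁ a₂)ᶜ *
              prob p (connEvent ends a₂ b ∩ connEvent ends a₁ u ∩
                (connEvent ends a₁ o ∪ connEvent ends a₂ o) ∩ (connEvent ends a₁ a₂)ᶜ) -
            prob p (connEvent ends a₂ b ∩ (connEvent ends a₁ a₂)ᶜ) *
              prob p (connEvent ends a₁ u ∩ (connEvent ends a₁ o ∪ connEvent ends a₂ o) ∩
                (connEvent ends a₁ a₂)ᶜ)) -
        prob p ((connEvent ends a₁ o ∪ connEvent ends a₂ o) ∩ (connEvent ends a₁ a₂)ᶜ) *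
          (prob p (connEvent ends a₁ a₂)ᶜ *
              prob p (connEvent ends a₂ b ∩ connEvent ends a₁ u ∩ (connEvent ends a₁ a₂)ᶜ) -
            prob p (connEvent ends a₂ b ∩ (connEvent ends a₁ a₂)ᶜ) *
              prob p (connEvent ends a₁ u ∩ (connEvent ends a₁ a₂)ᶜ)) -
        prob p (connEvent ends a₁ a₂)ᶜ *
          (prob p (connEvent ends a₁ a₂)ᶜ *
              prob p (connEvent ends a₂ b ∩ connEvent ends a₁ o ∩ (connEvent ends a₁ a₂)ᶜ) -
            prob p (connEvent ends a₂ b ∩ (connEvent ends a₁ a₂)ᶜ) *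
              prob p (connEvent ends a₁ o ∩ (connEvent ends a₁ a₂)ᶜ)) := by
  have hu : u ≠ a₂ := hl.ne
  have hQ : connEvent ends a₁ a₂ = openEdge e₀ ∩ connEvent ends a₁ u := connEvent_leaf hl h1
  have hHb : connEvent ends a₂ b = openEdge e₀ ∩ connEvent ends u b := by
    rw [connEvent_leaf' hl hb, connEvent_comm ends b u]
  have hHo : connEvent ends a₂ o = openEdge e₀ ∩ connEvent ends o u := connEvent_leaf' hl ho
  rw [hQ, hHb, hHo]
  set A := connEvent ends a₁ u with hA
  set O := openEdge e₀ with hO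
  set Xb := connEvent ends u b with hXb
  set Lo := connEvent ends a₁ o with hLo
  set Xo := connEvent ends o u with hXo
  have dA : DependsOn (· ∈ A) ({e₀}ᶜ : Set E) := dependsOn_connEvent_of_leaf hl h1 hu
  have dXb : DependsOn (· ∈ Xb) ({e₀}ᶜ : Set E) := dependsOn_connEvent_of_leaf hl hu hb
  have dLo : DependsOn (· ∈ Lo) ({e₀}ᶜ : Set E) := dependsOn_connEvent_of_leaf hl h1 ho
  have dXo : DependsOn (· ∈ Xo) ({e₀}ᶜ : Set E) := dependsOn_connEvent_of_leaf hl ho hu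
  have dAc : DependsOn (· ∈ Aᶜ) ({e₀}ᶜ : Set E) := dependsOn_compl dA
  have hLoXo : Lo ∩ Xo ⊆ A := fun ω hω => conn_trans hω.1 hω.2
  have hdisj1 : Disjoint (Lo ∩ (O ∩ A)ᶜ) ((Xo ∩ Aᶜ) ∩ O) := by
    rw [Set.disjoint_left]
    rintro ω ⟨hLo', hc⟩ ⟨⟨hXo', hA'⟩, hO'⟩
    exact hA' (hLoXo ⟨hLo', hXo'⟩)
  have hβ0 : 0 ≤ p e₀ := hp.nonneg e₀
  have hβ1 : p e₀ ≤ 1 := hp.le_one e₀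
  have htu1 : prob p A ≤ 1 := prob_le_one hp A
  have hAc : prob p Aᶜ = 1 - prob p A := prob_compl p A
  have hsplit_o : prob p (Lo ∩ A) + prob p (Lo ∩ Aᶜ) = prob p Lo :=
    prob_inter_add_prob_inter_compl p Lo A
  -- dictionary
  have d0 : prob p (O ∩ A)ᶜ = 1 - prob p A * p e₀ := by
    rw [prob_compl, Set.inter_comm, prob_inter_openEdge_of_dependsOn p dA]
  have e1 : prob p (O ∩ Xb ∩ (O ∩ A)ᶜ) = prob p (Xb ∩ Aᶜ) * p e₀ := by
    rw [set_d4, prob_inter_openEdge_of_dependsOn p (dep_inter dXb dAc)]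
  have e2 : prob p (A ∩ (O ∩ A)ᶜ) = prob p A * (1 - p e₀) := by
    rw [set_e2, prob_inter_compl_openEdge_of_dependsOn p dA]
  have e3 : prob p (O ∩ Xb ∩ A ∩ (O ∩ A)ᶜ) = 0 := by
    rw [set_e3, prob_empty]
  have e4 : prob p (Lo ∩ (O ∩ A)ᶜ) = prob p Lo - prob p (Lo ∩ A) * p e₀ := by
    have := prob_inter_add_prob_inter_compl p Lo (O ∩ A)
    rw [set_d1, prob_inter_openEdge_of_dependsOn p (dep_inter dLo dA)] at this
    linarith
  have e5 : prob p (O ∩ Xb ∩ Lo ∩ (O ∩ A)ᶜ) = prob p (Lo ∩ Xb ∩ Aᶜ) * p e₀ := by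
    rw [set_e5, prob_inter_openEdge_of_dependsOn p (dep_inter (dep_inter dLo dXb) dAc)]
  have e6 : prob p ((Lo ∪ O ∩ Xo) ∩ (O ∩ A)ᶜ) =
      (prob p Lo - prob p (Lo ∩ A) * p e₀) + prob p (Xo ∩ Aᶜ) * p e₀ := by
    rw [set_d6, prob_union_of_disjoint p hdisj1, e4,
      prob_inter_openEdge_of_dependsOn p (dep_inter dXo dAc)]
  have e7 : prob p (A ∩ (Lo ∪ O ∩ Xo) ∩ (O ∩ A)ᶜ) = prob p (Lo ∩ A) * (1 - p e₀) := by
    rw [set_e7, prob_inter_compl_openEdge_of_dependsOn p (dep_inter dLo dA)]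
  have e8 : prob p (O ∩ Xb ∩ A ∩ (Lo ∪ O ∩ Xo) ∩ (O ∩ A)ᶜ) = 0 := by
    rw [set_e8, prob_empty]
  rw [d0, e1, e2, e3, e4, e5, e6, e7, e8]
  clear d0 e1 e2 e3 e4 e5 e6 e7 e8 hdisj1
  -- BHK 1.4 (cross-cluster given `a₁ ↮ u`) and Harris
  have hBHK := bhk_cross_cluster p hp ends a₁ u (𝓤 := {W : Set V | o ∈ W})
    (𝓥 := {W : Set V | b ∈ W}) (fun _ _ h hW => h hW) (fun _ _ h hW => h hW)
  rw [RProduct.clusterInEvent_mem_eq, RProduct.clusterInEvent_mem_eq] at hBHK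
  have hHarris_o := prob_mul_prob_le_prob_inter hp (isUpperSet_connEvent ends a₁ o)
    (isUpperSet_connEvent ends a₁ u)
  have hxo := prob_nonneg hp (Xo ∩ Aᶜ)
  have hxb := prob_nonneg hp (Xb ∩ Aᶜ)
  have hmo := prob_nonneg hp (Lo ∩ Aᶜ)
  have hyp := prob_nonneg hp (Lo ∩ Xb ∩ Aᶜ)
  have hkou := prob_nonneg hp (Lo ∩ A)
  have htu0 := prob_nonneg hp A
  have hxb_le : prob p (Xb ∩ Aᶜ) ≤ prob p Aᶜ := prob_mono hp Set.inter_subset_right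
  have hmo_le : prob p (Lo ∩ Aᶜ) ≤ prob p Aᶜ := prob_mono hp Set.inter_subset_right
  have hxo_le : prob p (Xo ∩ Aᶜ) ≤ prob p Aᶜ := prob_mono hp Set.inter_subset_right
  have hyp_le : prob p (Lo ∩ Xb ∩ Aᶜ) ≤ prob p Aᶜ := prob_mono hp Set.inter_subset_right
  rw [← hsplit_o]
  rw [← hsplit_o] at hHarris_o
  clear hsplit_o dA dXb dLo dXo dAc hLoXo
  generalize hβ : p e₀ = β at *
  generalize htu : prob p A = tu at *
  generalize hac : prob p Aᶜ = ac at *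
  generalize hkou' : prob p (Lo ∩ A) = kou at *
  generalize hmo' : prob p (Lo ∩ Aᶜ) = mo at *
  generalize hxo' : prob p (Xo ∩ Aᶜ) = xo at *
  generalize hxb' : prob p (Xb ∩ Aᶜ) = xb at *
  generalize hyp' : prob p (Lo ∩ Xb ∩ Aᶜ) = yp at *
  clear hβ htu hac hkou' hmo' hxo' hxb' hyp' hQ hHb hHo hl h1 ho hb hu
  subst hAc
  have hD : 0 ≤ xb * mo - yp * (1 - tu) := by linarith only [hBHK]
  have hCo : 0 ≤ kou - tu * (kou + mo) := by linarith only [hHarris_o]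
  have key : (1 - tu) *
      ((1 - tu * β) * ((1 - tu * β) * 0 - xb * β * (kou * (1 - β))) -
        (kou + mo - kou * β + xo * β) * ((1 - tu * β) * 0 - xb * β * (tu * (1 - β))) -
        (1 - tu * β) * ((1 - tu * β) * (yp * β) - xb * β * (kou + mo - kou * β))) =
      β * ((1 - β) * tu * xb * ((1 - β) * (kou - tu * (kou + mo)) + β * (1 - tu) * xo) +
        (1 - tu * β) * (1 - tu * β) * (xb * mo - yp * (1 - tu))) := by
    ring
  have h1β : 0 ≤ 1 - β := by linarith only [hβ1]
  have h1tu : 0 ≤ 1 - tu := by linarith only [htu1]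
  have hRHS : 0 ≤ β * ((1 - β) * tu * xb * ((1 - β) * (kou - tu * (kou + mo)) + β * (1 - tu) * xo) +
        (1 - tu * β) * (1 - tu * β) * (xb * mo - yp * (1 - tu))) := by
    apply mul_nonneg hβ0
    apply add_nonneg
    · apply mul_nonneg (mul_nonneg (mul_nonneg h1β htu0) hxb)
      exact add_nonneg (mul_nonneg h1β hCo) (mul_nonneg (mul_nonneg hβ0 h1tu) hxo)
    · exact mul_nonneg (mul_self_nonneg _) hD
  rcases eq_or_lt_of_le h1tu with h | h
  · have z1 : xb = 0 := le_antisymm (by linarith only [hxb_le, h]) hxb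
    have z2 : mo = 0 := le_antisymm (by linarith only [hmo_le, h]) hmo
    have z3 : xo = 0 := le_antisymm (by linarith only [hxo_le, h]) hxo
    have z4 : yp = 0 := le_antisymm (by linarith only [hyp_le, h]) hyp
    have htu' : tu = 1 := by linarith only [h]
    rw [z1, z2, z3, z4, htu']
    ring_nf
    exact le_refl _
  · exact (mul_nonneg_iff_of_pos_left h).mp (key ▸ hRHS)

end MainH

end LeafRootPMH

end Summit.Ventures.PercRepro2
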